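import Literature.Computability.AlgebraicComplexity.BigCwComponents
import HarnessLib

/-!
# The level-2 decomposition of `CW_q ⊗ CW_q` and the matrix shapes of its components
(Coppersmith–Winograd 1990, §8) — proved

Topic `Literature/Computability/AlgebraicComplexity`.  Coppersmith–Winograd 1990, §8 analyse
`CW_q^{⊗2}` with the variables `x_{ij}` grouped by `I = level(i) + level(j) ∈ {0,…,4}`: the
non-zero blocks `X^{[I]} Y^{[J]} Z^{[K]}` have `I + J + K = 4`, and
"`[004]` is a scalar `x_{00} y_{00} z_{q+1,q+1}`, `[013]` is a matrix product `⟨1,1,2q⟩`,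
`[022]` is a matrix product `⟨1,1,q²+2⟩`, while `[112]` … is not a matrix product" (§8; also
Le Gall 2014 §5 / Table 2, BCS 1997 Ex. 15.??).  In the coordinates of the tree
(`bigCwSq K q = CW_q ⊗ CW_q` on pairs of indices, labels `cwLev2 = level sum ∈ Fin 5`, pair labels
`cwPairLev ∈ Fin 3 × Fin 3`) this file PROVES:

* `cwLevSum`, `cwPairLev`, `cwLev2` (`= cwLevSum ∘ cwPairLev`), the support `cwSupport₂ =
  {I+J+K = 4}` (`bigCwSq_cwSupport₂`), tightness data `cwTight₂`, `cwTight₂γ` (`r = 1`, bound `4`);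
  `cwSqComp q I J K` — the level-2 component (zero-out); `rotate_bigCwTensor`, `rotate_bigCwSq`,
  `cwSqComp_rotate` (cyclic symmetry: `T^{[KIJ]} = (T^{[IJK]})_C`).
* **The matrix components**: `tensorRestrictsTo_cwSqComp004` (`≥ ⟨1,1,1⟩`),
  `tensorRestrictsTo_cwSqComp013`, `…031` (`≥ ⟨1,2q,1⟩`), `tensorRestrictsTo_cwSqComp022`
  (`≥ ⟨1, q²+2, 1⟩`), with the Le Gall values of all twelve matrix components
  (`hasLaserValue_symm3_cwSqComp_004/040/400/013/301/130/031/103/310/022/202/220`).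
* **The pair decomposition of `[112]`** (`cwSqComp_pair`: its pair-label components are the
  products `T_{ijl} ⊗ T_{i'j'l'}` of level-1 components, or `0`), used in
  `BigCwSquareValue112.lean`.

Everything is proved; definitions are label maps/abbreviations; no named facts.

## References

* D. Coppersmith, S. Winograd, J. Symbolic Comput. 9 (1990), §8. [CoppersmithWinograd1990]
* F. Le Gall, ISSAC 2014, arXiv:1401.7714, §5. [LeGall2014]
-/

noncomputable section

open scoped BigOperators
open Finset

namespace Literature.Computability.AlgebraicComplexity

open Literature.Barriers.MatrixMultiplication (bigCwTensor bigCwTensor_apply bigCwTensor_corner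
  bigCwTensor_zero)

universe u

/-! ## More entries of `CW_q` -/

section Entries

variable (K : Type u) [CommSemiring K] (q : ℕ)

/-- `CW_q(0, 0, i) = 0` for a middle index. [cite: CoppersmithWinograd1990, §7 eq. (10)] -/
theorem bigCwTensor_zero_zero_mid (i : Fin q) : bigCwTensor K q 0 0 (cwMid i) = 0 := by
  simp [bigCwTensor, cwMid_ne_zero, cwMid_ne_last, zero_ne_cwMid]

/-- `CW_q(0, i, 0) = 0` for a middle index. [cite: CoppersmithWinograd1990, §7 eq. (10)] -/
theorem bigCwTensor_zero_mid_zero (i : Fin q) : bigCwTensor K q 0 (cwMid i) 0 = 0 := by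
  simp [bigCwTensor, cwMid_ne_zero, cwMid_ne_last, zero_ne_cwMid]

/-- `CW_q(0, i, q+1) = 0` for a middle index. [cite: CoppersmithWinograd1990, §7 eq. (10)] -/
theorem bigCwTensor_zero_mid_last (i : Fin q) : bigCwTensor K q 0 (cwMid i) (Fin.last (q + 1)) = 0 := by
  simp [bigCwTensor, cwMid_ne_zero, cwMid_ne_last, zero_ne_cwMid]

/-- `CW_q(0, q+1, i) = 0` for a middle index. [cite: CoppersmithWinograd1990, §7 eq. (10)] -/
theorem bigCwTensor_zero_last_mid (i : Fin q) : bigCwTensor K q 0 (Fin.last (q + 1)) (cwMid i) = 0 := by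
  simp [bigCwTensor, Fin.ext_iff]

/-- `CW_q(0, q+1, q+1) = 0`. [cite: CoppersmithWinograd1990, §7 eq. (10)] -/
theorem bigCwTensor_zero_last_last : bigCwTensor K q 0 (Fin.last (q + 1)) (Fin.last (q + 1)) = 0 := by
  simp [bigCwTensor, Fin.ext_iff]

end Entries

/-! ## Labels of the square -/

section Labels

variable {q : ℕ}

/-- The sum of a pair of levels, in `Fin 5`. [folklore] -/
def cwLevSum (p : Fin 3 × Fin 3) : Fin 5 :=
  ⟨p.1 + p.2, by have := p.1.isLt; have := p.2.isLt; omega⟩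

/-- `cwLevSum` as a natural number. [folklore] -/
@[simp] theorem coe_cwLevSum (p : Fin 3 × Fin 3) : (cwLevSum p : ℕ) = p.1 + p.2 := rfl

/-- Pair labels of `CW_q ⊗ CW_q`: the two levels. [cite: LeGall2014, §5] -/
abbrev cwPairLev (x : Fin (q + 2) × Fin (q + 2)) : Fin 3 × Fin 3 := (cwLevel₃ x.1, cwLevel₃ x.2)

/-- **Level-2 labels of `CW_q ⊗ CW_q`**: the sum of the two levels ("`x_{ij} ∈ X^{[I]}`,
`I = level(i) + level(j)`"). [cite: CoppersmithWinograd1990, §8] -/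
abbrev cwLev2 (x : Fin (q + 2) × Fin (q + 2)) : Fin 5 := cwLevSum (cwPairLev x)

/-- `x_{00}` has level `0`. [cite: CoppersmithWinograd1990, §8] -/
@[simp] theorem cwLev2_zero_zero : cwLev2 (((0 : Fin (q + 2))), ((0 : Fin (q + 2)))) = 0 := by
  ext; simp
/-- `x_{0i}` has level `1`. [cite: CoppersmithWinograd1990, §8] -/
@[simp] theorem cwLev2_zero_mid (i : Fin q) : cwLev2 (((0 : Fin (q + 2))), cwMid i) = 1 := by
  ext; simp
/-- `x_{i0}` has level `1`. [cite: CoppersmithWinograd1990, §8] -/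
@[simp] theorem cwLev2_mid_zero (i : Fin q) : cwLev2 (cwMid i, ((0 : Fin (q + 2)))) = 1 := by
  ext; simp
/-- `x_{0,q+1}` has level `2`. [cite: CoppersmithWinograd1990, §8] -/
@[simp] theorem cwLev2_zero_last : cwLev2 (((0 : Fin (q + 2))), Fin.last (q + 1)) = 2 := by
  ext; simp
/-- `x_{q+1,0}` has level `2`. [cite: CoppersmithWinograd1990, §8] -/
@[simp] theorem cwLev2_last_zero : cwLev2 (Fin.last (q + 1), ((0 : Fin (q + 2)))) = 2 := by
  ext; simp
/-- `x_{ij}` has level `2`. [cite: CoppersmithWinograd1990, §8] -/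
@[simp] theorem cwLev2_mid_mid (i j : Fin q) : cwLev2 (cwMid i, cwMid j) = 2 := by
  ext; simp
/-- `x_{i,q+1}` has level `3`. [cite: CoppersmithWinograd1990, §8] -/
@[simp] theorem cwLev2_mid_last (i : Fin q) : cwLev2 (cwMid i, Fin.last (q + 1)) = 3 := by
  ext; simp
/-- `x_{q+1,i}` has level `3`. [cite: CoppersmithWinograd1990, §8] -/
@[simp] theorem cwLev2_last_mid (i : Fin q) : cwLev2 (Fin.last (q + 1), cwMid i) = 3 := by
  ext; simp
/-- `x_{q+1,q+1}` has level `4`. [cite: CoppersmithWinograd1990, §8] -/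
@[simp] theorem cwLev2_last_last : cwLev2 (Fin.last (q + 1), Fin.last (q + 1)) = 4 := by
  ext; simp

/-- **The level-2 support `{(I,J,K) | I + J + K = 4}`.** [cite: CoppersmithWinograd1990, §8] -/
def cwSupport₂ : Finset (Fin 5 × Fin 5 × Fin 5) :=
  Finset.univ.filter fun s => (s.1 : ℕ) + s.2.1 + s.2.2 = 4

/-- Membership in the level-2 support. [folklore] -/
theorem mem_cwSupport₂ {s : Fin 5 × Fin 5 × Fin 5} :
    s ∈ cwSupport₂ ↔ (s.1 : ℕ) + s.2.1 + s.2.2 = 4 := by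
  simp [cwSupport₂]

/-- Tightness vectors (first two coordinates): the label. [folklore] -/
def cwTight₂ (i : Fin 5) : Fin 1 → ℤ := fun _ => (i : ℕ)

/-- Tightness vector (third coordinate): the label minus `4`. [folklore] -/
def cwTight₂γ (l : Fin 5) : Fin 1 → ℤ := fun _ => (l : ℕ) - 4

/-- `cwTight₂` is injective. [folklore] -/
theorem cwTight₂_injective : Function.Injective cwTight₂ := fun i j h => by
  have := congrFun h 0
  simp only [cwTight₂, Nat.cast_inj] at this
  exact Fin.ext this

/-- `cwTight₂γ` is injective. [folklore] -/
theorem cwTight₂γ_injective : Function.Injective cwTight₂γ := fun i j h => by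
  have := congrFun h 0
  simp only [cwTight₂γ, sub_left_inj, Nat.cast_inj] at this
  exact Fin.ext this

/-- `|cwTight₂ i| ≤ 4`. [folklore] -/
theorem cwTight₂_bound (i : Fin 5) (k : Fin 1) : |cwTight₂ i k| ≤ (4 : ℕ) := by
  simp only [cwTight₂]
  have := i.isLt
  rw [abs_of_nonneg (by positivity)]
  exact_mod_cast (by omega : (i : ℕ) ≤ 4)

/-- The tightness relation on the level-2 support. [folklore] -/
theorem cwTight₂_sum (s : Fin 5 × Fin 5 × Fin 5) (hs : s ∈ cwSupport₂) (k : Fin 1) :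
    cwTight₂ s.1 k + cwTight₂ s.2.1 k + cwTight₂γ s.2.2 k = 0 := by
  rw [mem_cwSupport₂] at hs
  simp only [cwTight₂, cwTight₂γ]
  omega

end Labels

/-! ## The square, its support, its components -/

section Square

variable (K : Type u) [Field K] (q : ℕ)

/-- **`CW_q ⊗ CW_q`** on pairs of indices. [cite: CoppersmithWinograd1990, §8] -/
abbrev bigCwSq : Fin (q + 2) × Fin (q + 2) → Fin (q + 2) × Fin (q + 2) → Fin (q + 2) × Fin (q + 2) → K :=
  kroneckerTensor (bigCwTensor K q) (bigCwTensor K q)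

/-- **The support of `CW_q^{⊗2}` has level sums adding to `4`.** [cite: CoppersmithWinograd1990, §8] -/
theorem bigCwSq_cwSupport₂ (x y z : Fin (q + 2) × Fin (q + 2)) (h : bigCwSq K q x y z ≠ 0) :
    (cwLev2 x, cwLev2 y, cwLev2 z) ∈ cwSupport₂ := by
  have h' : bigCwTensor K q x.1 y.1 z.1 * bigCwTensor K q x.2 y.2 z.2 ≠ 0 := h
  clear h
  have h := h'
  have h1 := bigCwTensor_level_sum K (left_ne_zero_of_mul h)
  have h2 := bigCwTensor_level_sum K (right_ne_zero_of_mul h)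
  rw [mem_cwSupport₂]
  simp only [coe_cwLevSum, cwLevel₃_val]
  omega

/-- The pair labels of the support of `CW_q^{⊗2}` lie in `cwSupport₃ × cwSupport₃`. [cite: LeGall2014, §5] -/
theorem bigCwSq_pairSupport (x y z : Fin (q + 2) × Fin (q + 2)) (h : bigCwSq K q x y z ≠ 0) :
    ((cwPairLev x).1, (cwPairLev y).1, (cwPairLev z).1) ∈ cwSupport₃ ∧
      ((cwPairLev x).2, (cwPairLev y).2, (cwPairLev z).2) ∈ cwSupport₃ := by
  have h' : bigCwTensor K q x.1 y.1 z.1 * bigCwTensor K q x.2 y.2 z.2 ≠ 0 := h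
  clear h
  have h := h'
  exact ⟨cwLevel₃_mem_support K (left_ne_zero_of_mul h), cwLevel₃_mem_support K (right_ne_zero_of_mul h)⟩

/-- **The level-2 component `T^{[IJK]}` of `CW_q^{⊗2}`.** [cite: CoppersmithWinograd1990, §8] -/
abbrev cwSqComp (I J L : Fin 5) :
    Fin (q + 2) × Fin (q + 2) → Fin (q + 2) × Fin (q + 2) → Fin (q + 2) × Fin (q + 2) → K :=
  partSubtensor cwLev2 cwLev2 cwLev2 (bigCwSq K q) {I} {J} {L}

/-! ### Cyclic symmetry -/

/-- `CW_q` is invariant under cyclic rotation of its three slots. [cite: CoppersmithWinograd1990, §7 eq. (10)] -/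
theorem rotate_bigCwTensor : rotate (bigCwTensor K q) = bigCwTensor K q := by
  funext b c a
  rw [rotate_apply, bigCwTensor_apply, bigCwTensor_apply]
  refine if_congr ?_ rfl rfl
  constructor
  · rintro (⟨h1, h2, h3, h4⟩ | ⟨h1, h2, h3, h4⟩ | ⟨h1, h2, h3, h4⟩ | ⟨h1, h2, h3⟩ | ⟨h1, h2, h3⟩ |
      ⟨h1, h2, h3⟩)
    · exact Or.inr (Or.inr (Or.inl ⟨h1, h2, h3, h4⟩))
    · exact Or.inl ⟨h1, h2.symm, (by rw [← h2]; exact h3), (by rw [← h2]; exact h4)⟩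
    · exact Or.inr (Or.inl ⟨h1, h2.symm, (by rw [← h2]; exact h3), (by rw [← h2]; exact h4)⟩)
    · exact Or.inr (Or.inr (Or.inr (Or.inr (Or.inl ⟨h2, h3, h1⟩))))
    · exact Or.inr (Or.inr (Or.inr (Or.inr (Or.inr ⟨h2, h3, h1⟩))))
    · exact Or.inr (Or.inr (Or.inr (Or.inl ⟨h2, h3, h1⟩)))
  · rintro (⟨h1, h2, h3, h4⟩ | ⟨h1, h2, h3, h4⟩ | ⟨h1, h2, h3, h4⟩ | ⟨h1, h2, h3⟩ | ⟨h1, h2, h3⟩ |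
      ⟨h1, h2, h3⟩)
    · exact Or.inr (Or.inl ⟨h1, h2.symm, (by rw [← h2]; exact h3), (by rw [← h2]; exact h4)⟩)
    · exact Or.inr (Or.inr (Or.inl ⟨h1, h2.symm, (by rw [← h2]; exact h3), (by rw [← h2]; exact h4)⟩))
    · exact Or.inl ⟨h1, h2, h3, h4⟩
    · exact Or.inr (Or.inr (Or.inr (Or.inr (Or.inr ⟨h3, h1, h2⟩))))
    · exact Or.inr (Or.inr (Or.inr (Or.inl ⟨h3, h1, h2⟩)))
    · exact Or.inr (Or.inr (Or.inr (Or.inr (Or.inl ⟨h3, h1, h2⟩))))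

/-- `CW_q^{⊗2}` is invariant under cyclic rotation. [cite: CoppersmithWinograd1990, §8] -/
theorem rotate_bigCwSq : rotate (bigCwSq K q) = bigCwSq K q := by
  rw [show bigCwSq K q = kroneckerTensor (bigCwTensor K q) (bigCwTensor K q) from rfl, rotate_kroneckerTensor,
    rotate_bigCwTensor]

/-- **`T^{[KIJ]} = (T^{[IJK]})_C`**: the level-2 components are permuted cyclically by the rotation.
[cite: CoppersmithWinograd1990, §8] -/
theorem cwSqComp_rotate (I J L : Fin 5) : cwSqComp K q J L I = rotate (cwSqComp K q I J L) := by
  rw [show cwSqComp K q J L I = partSubtensor cwLev2 cwLev2 cwLev2 (rotate (bigCwSq K q)) {J} {L} {I} by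
    rw [rotate_bigCwSq]]
  exact partSubtensor_rotate _ _ _ _ _ _ _

/-! ### The matrix components -/

/-- **`T^{[004]} = x_{00} y_{00} z_{q+1,q+1} ≥ ⟨1,1,1⟩`.** [cite: CoppersmithWinograd1990, §8] -/
theorem tensorRestrictsTo_cwSqComp004 : TensorRestrictsTo (cwSqComp K q 0 0 4) (matMulTensor K 1 1 1) := by
  refine tensorRestrictsTo_matMulTensor_mid _ ((0 : Fin (q + 2)), (0 : Fin (q + 2)))
    (fun _ => ((0 : Fin (q + 2)), (0 : Fin (q + 2))))
    (fun _ => (Fin.last (q + 1), Fin.last (q + 1))) fun i j => ?_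
  have hij : i = j := Subsingleton.elim _ _
  simp only [partSubtensor_apply, Finset.mem_singleton, kroneckerTensor_apply, hij, if_true]
  rw [if_pos (by refine ⟨?_, ?_, ?_⟩ <;> ext <;> simp)]
  rw [bigCwTensor_corner]; simp

/-- The `y`-indices of `T^{[013]}`: `(0, i)` and `(i, 0)`. [folklore] -/
def cwIdx01 (s : Fin q ⊕ Fin q) : Fin (q + 2) × Fin (q + 2) :=
  Sum.elim (fun i => ((0 : Fin (q + 2)), cwMid i)) (fun i => (cwMid i, (0 : Fin (q + 2)))) s

/-- The `z`-indices of `T^{[013]}` paired with `cwIdx01`: `(q+1, i)` and `(i, q+1)`. [folklore] -/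
def cwIdx21 (s : Fin q ⊕ Fin q) : Fin (q + 2) × Fin (q + 2) :=
  Sum.elim (fun i => (Fin.last (q + 1), cwMid i)) (fun i => (cwMid i, Fin.last (q + 1))) s

/-- **`T^{[013]} = x_{00} (∑ᵢ y_{0i} z_{q+1,i} + ∑ᵢ y_{i0} z_{i,q+1}) ≥ ⟨1, 2q, 1⟩`.**
[cite: CoppersmithWinograd1990, §8] -/
theorem tensorRestrictsTo_cwSqComp013 :
    TensorRestrictsTo (cwSqComp K q 0 1 3) (matMulTensor K 1 (q + q) 1) := by
  refine tensorRestrictsTo_matMulTensor_mid _ ((0 : Fin (q + 2)), (0 : Fin (q + 2)))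
    (fun β => cwIdx01 q (finSumFinEquiv.symm β)) (fun β => cwIdx21 q (finSumFinEquiv.symm β))
    fun β β' => ?_
  obtain ⟨s, rfl⟩ := finSumFinEquiv.surjective β
  obtain ⟨s', rfl⟩ := finSumFinEquiv.surjective β'
  simp only [Equiv.symm_apply_apply, Equiv.apply_eq_iff_eq]
  rcases s with i | i <;> rcases s' with j | j
  · simp only [cwIdx01, cwIdx21, Sum.elim_inl, partSubtensor_apply, Finset.mem_singleton,
      kroneckerTensor_apply, Sum.inl.injEq]
    rw [if_pos (by refine ⟨?_, ?_, ?_⟩ <;> ext <;> simp), bigCwTensor_corner, bigCwTensor_zero_mid_mid,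
      one_mul]
  · simp only [cwIdx01, cwIdx21, Sum.elim_inl, Sum.elim_inr, partSubtensor_apply, Finset.mem_singleton,
      kroneckerTensor_apply, reduceCtorEq, if_false]
    rw [bigCwTensor_zero_zero_mid, zero_mul, ite_self]
  · simp only [cwIdx01, cwIdx21, Sum.elim_inl, Sum.elim_inr, partSubtensor_apply, Finset.mem_singleton,
      kroneckerTensor_apply, reduceCtorEq, if_false]
    rw [bigCwTensor_zero_mid_last, zero_mul, ite_self]
  · simp only [cwIdx01, cwIdx21, Sum.elim_inr, partSubtensor_apply, Finset.mem_singleton,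
      kroneckerTensor_apply, Sum.inr.injEq]
    rw [if_pos (by refine ⟨?_, ?_, ?_⟩ <;> ext <;> simp), bigCwTensor_corner, bigCwTensor_zero_mid_mid,
      mul_one]

/-- The `y`-indices of `T^{[031]}`: `(q+1, i)` and `(i, q+1)`; paired `z`-indices `(0,i)`, `(i,0)`
(`cwIdx21`, `cwIdx01`). **`T^{[031]} ≥ ⟨1, 2q, 1⟩`.** [cite: CoppersmithWinograd1990, §8] -/
theorem tensorRestrictsTo_cwSqComp031 :
    TensorRestrictsTo (cwSqComp K q 0 3 1) (matMulTensor K 1 (q + q) 1) := by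
  refine tensorRestrictsTo_matMulTensor_mid _ ((0 : Fin (q + 2)), (0 : Fin (q + 2)))
    (fun β => cwIdx21 q (finSumFinEquiv.symm β)) (fun β => cwIdx01 q (finSumFinEquiv.symm β))
    fun β β' => ?_
  obtain ⟨s, rfl⟩ := finSumFinEquiv.surjective β
  obtain ⟨s', rfl⟩ := finSumFinEquiv.surjective β'
  simp only [Equiv.symm_apply_apply, Equiv.apply_eq_iff_eq]
  rcases s with i | i <;> rcases s' with j | j
  · simp only [cwIdx01, cwIdx21, Sum.elim_inl, partSubtensor_apply, Finset.mem_singleton,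
      kroneckerTensor_apply, Sum.inl.injEq]
    rw [if_pos (by refine ⟨?_, ?_, ?_⟩ <;> ext <;> simp), bigCwTensor_zero_last_zero,
      bigCwTensor_zero_mid_mid, one_mul]
  · simp only [cwIdx01, cwIdx21, Sum.elim_inl, Sum.elim_inr, partSubtensor_apply, Finset.mem_singleton,
      kroneckerTensor_apply, reduceCtorEq, if_false]
    rw [bigCwTensor_zero_last_mid, zero_mul, ite_self]
  · simp only [cwIdx01, cwIdx21, Sum.elim_inl, Sum.elim_inr, partSubtensor_apply, Finset.mem_singleton,
      kroneckerTensor_apply, reduceCtorEq, if_false]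
    rw [bigCwTensor_zero_mid_zero, zero_mul, ite_self]
  · simp only [cwIdx01, cwIdx21, Sum.elim_inr, partSubtensor_apply, Finset.mem_singleton,
      kroneckerTensor_apply, Sum.inr.injEq]
    rw [if_pos (by refine ⟨?_, ?_, ?_⟩ <;> ext <;> simp), bigCwTensor_zero_last_zero,
      bigCwTensor_zero_mid_mid, mul_one]

/-- The enumeration of the `q² + 2` level-2 index pairs used for `T^{[022]}`. [folklore] -/
def cwIdx2Equiv : Fin (q * q + 2) ≃ (Fin q × Fin q) ⊕ Fin 2 :=
  finSumFinEquiv.symm.trans (Equiv.sumCongr finProdFinEquiv.symm (Equiv.refl _))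

/-- The `y`-indices of `T^{[022]}`: `(i,j)`, `(0,q+1)`, `(q+1,0)`. [folklore] -/
def cwIdxY22 (s : (Fin q × Fin q) ⊕ Fin 2) : Fin (q + 2) × Fin (q + 2) :=
  Sum.elim (fun ij => (cwMid ij.1, cwMid ij.2))
    (fun k => ![((0 : Fin (q + 2)), Fin.last (q + 1)), (Fin.last (q + 1), (0 : Fin (q + 2)))] k) s

/-- The `z`-indices of `T^{[022]}` paired with `cwIdxY22`: `(i,j)`, `(q+1,0)`, `(0,q+1)`. [folklore] -/
def cwIdxZ22 (s : (Fin q × Fin q) ⊕ Fin 2) : Fin (q + 2) × Fin (q + 2) :=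
  Sum.elim (fun ij => (cwMid ij.1, cwMid ij.2))
    (fun k => ![(Fin.last (q + 1), (0 : Fin (q + 2))), ((0 : Fin (q + 2)), Fin.last (q + 1))] k) s

/-- **`T^{[022]} = x_{00} (∑_{i,j} y_{ij} z_{ij} + y_{0,q+1} z_{q+1,0} + y_{q+1,0} z_{0,q+1}) ≥ ⟨1, q²+2, 1⟩`.**
[cite: CoppersmithWinograd1990, §8] -/
theorem tensorRestrictsTo_cwSqComp022 :
    TensorRestrictsTo (cwSqComp K q 0 2 2) (matMulTensor K 1 (q * q + 2) 1) := by
  refine tensorRestrictsTo_matMulTensor_mid _ ((0 : Fin (q + 2)), (0 : Fin (q + 2)))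
    (fun β => cwIdxY22 q (cwIdx2Equiv q β)) (fun β => cwIdxZ22 q (cwIdx2Equiv q β)) fun β β' => ?_
  obtain ⟨s, rfl⟩ := (cwIdx2Equiv q).symm.surjective β
  obtain ⟨s', rfl⟩ := (cwIdx2Equiv q).symm.surjective β'
  simp only [Equiv.apply_symm_apply, Equiv.apply_eq_iff_eq]
  rcases s with ⟨i, j⟩ | k <;> rcases s' with ⟨i', j'⟩ | k'
  · -- middle/middle
    simp only [cwIdxY22, cwIdxZ22, Sum.elim_inl, partSubtensor_apply, Finset.mem_singleton,
      kroneckerTensor_apply, Sum.inl.injEq, Prod.mk.injEq]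
    rw [if_pos (by refine ⟨?_, ?_, ?_⟩ <;> ext <;> simp), bigCwTensor_zero_mid_mid,
      bigCwTensor_zero_mid_mid]
    by_cases h1 : i = i' <;> by_cases h2 : j = j' <;> simp [h1, h2]
  · simp only [cwIdxY22, cwIdxZ22, Sum.elim_inl, Sum.elim_inr, partSubtensor_apply, Finset.mem_singleton,
      kroneckerTensor_apply, reduceCtorEq, if_false]
    fin_cases k'
    · simp [bigCwTensor_zero_mid_last]
    · simp [bigCwTensor_zero_mid_zero]
  · simp only [cwIdxY22, cwIdxZ22, Sum.elim_inl, Sum.elim_inr, partSubtensor_apply, Finset.mem_singleton,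
      kroneckerTensor_apply, reduceCtorEq, if_false]
    fin_cases k
    · simp [bigCwTensor_zero_zero_mid]
    · simp [bigCwTensor_zero_last_mid]
  · simp only [cwIdxY22, cwIdxZ22, Sum.elim_inr, partSubtensor_apply, Finset.mem_singleton,
      kroneckerTensor_apply, Sum.inr.injEq]
    fin_cases k <;> fin_cases k'
    · simp [bigCwTensor_corner, bigCwTensor_zero_last_zero]
    · simp [bigCwTensor_zero]
    · simp [bigCwTensor_zero_last_last]
    · simp [bigCwTensor_corner, bigCwTensor_zero_last_zero]

/-! ### Le Gall values of the twelve matrix components -/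

variable (ρ : ℝ)

/-- Normalisation of the value of a `⟨1, m, 1⟩` component. [folklore] -/
theorem one_mul_mul_one_rpow_cube (m : ℕ) : (((1 * m * 1 : ℕ) : ℝ) ^ (ρ / 3)) ^ 3 = (((m : ℕ) : ℝ) ^ (ρ / 3)) ^ 3 := by
  rw [one_mul, mul_one]

/-- `V_ρ(T^{[004]}) ≥ 1`. [cite: CoppersmithWinograd1990, §8] -/
theorem hasLaserValue_symm3_cwSqComp004 : HasLaserValue ρ (symm3 (cwSqComp K q 0 0 4)) 1 := by
  have h := hasLaserValue_symm3_of_restrictsTo_matMulTensor ρ (tensorRestrictsTo_cwSqComp004 K q)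
  have e : (((1 * 1 * 1 : ℕ) : ℝ) ^ (ρ / 3)) ^ 3 = 1 := by simp
  rwa [e] at h

/-- `V_ρ(T^{[040]}) ≥ 1`. [cite: CoppersmithWinograd1990, §8] -/
theorem hasLaserValue_symm3_cwSqComp040 : HasLaserValue ρ (symm3 (cwSqComp K q 0 4 0)) 1 := by
  rw [cwSqComp_rotate K q 0 0 4]; exact (hasLaserValue_symm3_cwSqComp004 K q ρ).symm3_rotate

/-- `V_ρ(T^{[400]}) ≥ 1`. [cite: CoppersmithWinograd1990, §8] -/
theorem hasLaserValue_symm3_cwSqComp400 : HasLaserValue ρ (symm3 (cwSqComp K q 4 0 0)) 1 := by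
  rw [cwSqComp_rotate K q 0 4 0]; exact (hasLaserValue_symm3_cwSqComp040 K q ρ).symm3_rotate

/-- `V_ρ(T^{[013]}) ≥ (2q)^{ρ/3}`. [cite: CoppersmithWinograd1990, §8] -/
theorem hasLaserValue_symm3_cwSqComp013 :
    HasLaserValue ρ (symm3 (cwSqComp K q 0 1 3)) ((((2 * q : ℕ) : ℝ) ^ (ρ / 3)) ^ 3) := by
  have h := hasLaserValue_symm3_of_restrictsTo_matMulTensor ρ (tensorRestrictsTo_cwSqComp013 K q)
  rwa [one_mul_mul_one_rpow_cube, ← two_mul] at h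

/-- `V_ρ(T^{[130]}) ≥ (2q)^{ρ/3}`. [cite: CoppersmithWinograd1990, §8] -/
theorem hasLaserValue_symm3_cwSqComp130 :
    HasLaserValue ρ (symm3 (cwSqComp K q 1 3 0)) ((((2 * q : ℕ) : ℝ) ^ (ρ / 3)) ^ 3) := by
  rw [cwSqComp_rotate K q 0 1 3]; exact (hasLaserValue_symm3_cwSqComp013 K q ρ).symm3_rotate

/-- `V_ρ(T^{[301]}) ≥ (2q)^{ρ/3}`. [cite: CoppersmithWinograd1990, §8] -/
theorem hasLaserValue_symm3_cwSqComp301 :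
    HasLaserValue ρ (symm3 (cwSqComp K q 3 0 1)) ((((2 * q : ℕ) : ℝ) ^ (ρ / 3)) ^ 3) := by
  rw [cwSqComp_rotate K q 1 3 0]; exact (hasLaserValue_symm3_cwSqComp130 K q ρ).symm3_rotate

/-- `V_ρ(T^{[031]}) ≥ (2q)^{ρ/3}`. [cite: CoppersmithWinograd1990, §8] -/
theorem hasLaserValue_symm3_cwSqComp031 :
    HasLaserValue ρ (symm3 (cwSqComp K q 0 3 1)) ((((2 * q : ℕ) : ℝ) ^ (ρ / 3)) ^ 3) := by
  have h := hasLaserValue_symm3_of_restrictsTo_matMulTensor ρ (tensorRestrictsTo_cwSqComp031 K q)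
  rwa [one_mul_mul_one_rpow_cube, ← two_mul] at h

/-- `V_ρ(T^{[310]}) ≥ (2q)^{ρ/3}`. [cite: CoppersmithWinograd1990, §8] -/
theorem hasLaserValue_symm3_cwSqComp310 :
    HasLaserValue ρ (symm3 (cwSqComp K q 3 1 0)) ((((2 * q : ℕ) : ℝ) ^ (ρ / 3)) ^ 3) := by
  rw [cwSqComp_rotate K q 0 3 1]; exact (hasLaserValue_symm3_cwSqComp031 K q ρ).symm3_rotate

/-- `V_ρ(T^{[103]}) ≥ (2q)^{ρ/3}`. [cite: CoppersmithWinograd1990, §8] -/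
theorem hasLaserValue_symm3_cwSqComp103 :
    HasLaserValue ρ (symm3 (cwSqComp K q 1 0 3)) ((((2 * q : ℕ) : ℝ) ^ (ρ / 3)) ^ 3) := by
  rw [cwSqComp_rotate K q 3 1 0]; exact (hasLaserValue_symm3_cwSqComp310 K q ρ).symm3_rotate

/-- `V_ρ(T^{[022]}) ≥ (q²+2)^{ρ/3}`. [cite: CoppersmithWinograd1990, §8] -/
theorem hasLaserValue_symm3_cwSqComp022 :
    HasLaserValue ρ (symm3 (cwSqComp K q 0 2 2)) ((((q * q + 2 : ℕ) : ℝ) ^ (ρ / 3)) ^ 3) := by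
  have h := hasLaserValue_symm3_of_restrictsTo_matMulTensor ρ (tensorRestrictsTo_cwSqComp022 K q)
  rwa [one_mul_mul_one_rpow_cube] at h

/-- `V_ρ(T^{[220]}) ≥ (q²+2)^{ρ/3}`. [cite: CoppersmithWinograd1990, §8] -/
theorem hasLaserValue_symm3_cwSqComp220 :
    HasLaserValue ρ (symm3 (cwSqComp K q 2 2 0)) ((((q * q + 2 : ℕ) : ℝ) ^ (ρ / 3)) ^ 3) := by
  rw [cwSqComp_rotate K q 0 2 2]; exact (hasLaserValue_symm3_cwSqComp022 K q ρ).symm3_rotate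

/-- `V_ρ(T^{[202]}) ≥ (q²+2)^{ρ/3}`. [cite: CoppersmithWinograd1990, §8] -/
theorem hasLaserValue_symm3_cwSqComp202 :
    HasLaserValue ρ (symm3 (cwSqComp K q 2 0 2)) ((((q * q + 2 : ℕ) : ℝ) ^ (ρ / 3)) ^ 3) := by
  rw [cwSqComp_rotate K q 2 2 0]; exact (hasLaserValue_symm3_cwSqComp220 K q ρ).symm3_rotate

/-! ### The pair decomposition of a level-2 component -/

/-- **The pair-label components of `T^{[IJK]}` are products of level-1 components**:
`(T^{[IJK]})_{(i,i'),(j,j'),(l,l')} = T_{ijl} ⊗ T_{i'j'l'}` if `i+i' = I`, `j+j' = J`, `l+l' = K`, and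
`0` otherwise (Le Gall §5: the component `(t⊗t)(a,b,c)` decomposed by
`{s | (a,b,c) − s ∈ supp}` with components `t(s) ⊗ t((a,b,c)−s)`). [cite: LeGall2014, §5 (p. 10)] -/
theorem cwSqComp_pair (I J L : Fin 5) (i i' j j' l l' : Fin 3) :
    partSubtensor cwPairLev cwPairLev cwPairLev (cwSqComp K q I J L) {(i, i')} {(j, j')} {(l, l')} =
      if cwLevSum (i, i') = I ∧ cwLevSum (j, j') = J ∧ cwLevSum (l, l') = L then
        kroneckerTensor (cwComp K q i j l) (cwComp K q i' j' l') else 0 := by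
  rw [show cwSqComp K q I J L = partSubtensor (fun x => cwLevSum (cwPairLev x))
      (fun y => cwLevSum (cwPairLev y)) (fun z => cwLevSum (cwPairLev z)) (bigCwSq K q) {I} {J} {L} from rfl,
    partSubtensor_partSubtensor_singleton]
  congr 1
  exact partSubtensor_kronecker cwLevel₃ cwLevel₃ cwLevel₃ cwLevel₃ cwLevel₃ cwLevel₃ _ _ i j l i' j' l'

end Square

end Literature.Computability.AlgebraicComplexity
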